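import Literature.AlgebraicGeometry.Resolution.MacaulayficationPStandard
import Literature.AlgebraicGeometry.Resolution.ColonSecantFiniteType
import Literature.AlgebraicGeometry.Resolution.ColonSecantColonProducts
import Mathlib.AlgebraicGeometry.Noetherian
import HarnessLib

/-!
# Colon-secant sequences are reversed `p`-standard sequences, and `p`-standard systems of parameters exist

Topic: `Literature/AlgebraicGeometry/Resolution` (bridge between the two vocabularies of the
commutative-algebra input of Kawasaki's Macaulayfication in the tree).

The tree carries Kawasaki's `p`-standard calculus [Kawasaki2000, §2–3] in two equivalent forms:
* `secantColonAnnihilator S M` (Schenzel's `𝔯(M)`) and `IsColonSecantSequence M rs`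
  (`SecantColonAnnihilator.lean`; Česnavičius's orientation `r₁,…,r_s`, CM-secant
  [Cesnavicius2021, Def. 3.1 (ii)] in colon form), for which **existence** is proved from the
  `Ext`-annihilator theorem over regular local rings (`SecantColonAnnihilatorExistence.lean`,
  `SecantColonAnnihilatorTransfer.lean`, `ColonSecantFiniteType.lean`);
* `KillsParameterColons M z` and `IsPStandard M xs` (`MacaulayficationPStandard.lean`; Kawasaki's
  orientation `x₁,…,x_d` [Kawasaki2000, Def. 2.6]), in which Kawasaki's Theorems 2.9, 2.10, 3.1
  are being formalized (`MacaulayficationPStandardDSequence.lean`,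
  `MacaulayficationKawasakiInduction.lean`).

Here we prove that they agree up to reversal and transfer the existence theorems:

* `killsParameterColons_iff_mem_secantColonAnnihilator` — `KillsParameterColons M z ↔ z ∈ 𝔯(M)`
  (units in a secant sequence make the colon condition trivial);
* `IsColonSecantSequence.isPStandard_reverse`, `IsPStandard.isColonSecantSequence_reverse`,
  `isPStandard_reverse_iff`;
* `exists_isPStandard_length_eq` (regular local base), `exists_isPStandard_of_surjective`
  (quotients of regular local rings), `exists_isPStandard_stalk` (stalks of schemes locally of
  finite type over a field): **`p`-standard systems of parameters of type `d-1` exist** for every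
  finite module of dimension `d` — Kawasaki's [Kawasaki2000, Thm. 2.7] (there: under a dualizing
  complex, via [Kawasaki2000, La. 2.4]) in the setting of `KawasakiMacaulayfication`, without
  dualizing complexes.

[cite: Kawasaki2000, Def. 2.6, Thm. 2.7; Cesnavicius2021, Def. 3.1 (ii); Schenzel1982, §2.4]
-/

noncomputable section

open IsLocalRing Ideal Module

universe u v

namespace Literature.AlgebraicGeometry.Resolution

variable {S : Type u} [CommRing S]

/-! ## `KillsParameterColons ↔ 𝔯` -/

section Kills

variable [IsLocalRing S] {N : Type v} [AddCommGroup N] [Module S N]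

/-- `z ∈ 𝔯(N)` kills the parameter colons of `N` in the sense of `KillsParameterColons` (no
`𝔪`-membership is asked there: a unit among `W, w` makes the colon condition trivial).
[cite: Kawasaki2000, La. 2.5] -/
theorem killsParameterColons_of_mem_secantColonAnnihilator {z : S}
    (hz : z ∈ secantColonAnnihilator S N) : KillsParameterColons N z := by
  intro W w hsec m hm
  rw [mem_colonBy] at hm ⊢
  by_cases hW : ∀ r ∈ W ++ [w], r ∈ maximalIdeal S
  · exact smul_mem_of_mem_secantColonAnnihilator hz hsec hW hm
  · simp only [not_forall, exists_prop] at hW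
    obtain ⟨r, hr, hru⟩ := hW
    have hunit : IsUnit r := by
      by_contra h
      exact hru ((IsLocalRing.mem_maximalIdeal r).mpr (mem_nonunits_iff.mpr h))
    rcases List.mem_append.mp hr with hr | hr
    · -- a unit in `W`: `(W)N = N`
      have hrW : r ∈ ofList W := Ideal.subset_span hr
      have htop : (ofList W • ⊤ : Submodule S N) = ⊤ := by
        rw [Ideal.eq_top_of_isUnit_mem (ofList W) hrW hunit, Submodule.top_smul]
      rw [htop]
      exact Submodule.mem_top
    · -- `w` is a unit: `m ∈ (W)N`
      rw [List.mem_singleton] at hr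
      subst hr
      obtain ⟨v, rfl⟩ := hunit
      have hm' : m ∈ (ofList W • ⊤ : Submodule S N) := by
        have := Submodule.smul_mem _ (↑v⁻¹ : S) hm
        rwa [smul_smul, Units.inv_mul, one_smul] at this
      exact Submodule.smul_mem _ _ hm'

/-- Conversely, `KillsParameterColons N z` puts `z` in `𝔯(N)` (apply it to the prefixes
`r₁,…,rᵢ ++ [rᵢ₊₁]` of a secant sequence). [cite: Kawasaki2000, La. 2.5] -/
theorem mem_secantColonAnnihilator_of_killsParameterColons {z : S} (hz : KillsParameterColons N z) :
    z ∈ secantColonAnnihilator S N := by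
  intro rs hrs _ i hi m hm
  have hsec : IsSecantSequence N (rs.take i ++ [rs[i]]) := by
    rw [← List.take_succ_eq_append_getElem hi]; exact hrs.take (i + 1)
  exact hz (rs.take i) rs[i] hsec hm

/-- **`KillsParameterColons N z ↔ z ∈ 𝔯(N)`** over a local ring.
[cite: Kawasaki2000, La. 2.5; Schenzel1982, §2.4] -/
theorem killsParameterColons_iff_mem_secantColonAnnihilator (z : S) :
    KillsParameterColons N z ↔ z ∈ secantColonAnnihilator S N :=
  ⟨mem_secantColonAnnihilator_of_killsParameterColons, killsParameterColons_of_mem_secantColonAnnihilator⟩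

end Kills

/-! ## `IsColonSecantSequence rs ↔ IsPStandard rs.reverse` -/

section Sequences

variable [IsNoetherianRing S] [IsLocalRing S] {M : Type v} [AddCommGroup M] [Module S M]
  [Module.Finite S M]

/-- **A colon-secant sequence read backwards is `p`-standard** (Kawasaki's orientation).
[cite: Kawasaki2000, Def. 2.6; Cesnavicius2021, Def. 3.1 (ii)] -/
theorem IsColonSecantSequence.isPStandard_reverse {rs : List S} (h : IsColonSecantSequence M rs) :
    IsPStandard M rs.reverse where
  mem_maximalIdeal x hx := h.mem_maximalIdeal x (List.mem_reverse.mp hx)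
  isSecantSequence := h.isSecantSequence.of_perm (List.reverse_perm rs).symm h.mem_maximalIdeal
  kills A x B hsplit := by
    -- `rs = B.reverse ++ x :: A.reverse`, so `x = rs[|B|]` and `rs.take |B| = B.reverse`
    have hrs : rs = B.reverse ++ x :: A.reverse := by
      have := congrArg List.reverse hsplit
      rwa [List.reverse_reverse, List.reverse_append, List.reverse_cons, List.append_assoc,
        List.singleton_append] at this
    have hi : B.length < rs.length := by
      rw [hrs, List.length_append, List.length_cons, List.length_reverse]; omega
    have htake : rs.take B.length = B.reverse := by
      rw [hrs]; exact List.take_left' (List.length_reverse)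
    have hget : rs[B.length] = x := by
      rw [List.getElem_of_eq hrs, List.getElem_append_right (by simp)]
      simp
    have h𝔯 := h.getElem_mem hi
    have hBeq : (ofList (rs.take B.length) • ⊤ : Submodule S M) = ofList B • ⊤ := by
      rw [htake, ofList_reverse]
    rw [hget, secantColonAnnihilator_quotient_congr hBeq] at h𝔯
    exact killsParameterColons_of_mem_secantColonAnnihilator h𝔯

/-- **A `p`-standard sequence read backwards is colon-secant** (Česnavičius's orientation).
[cite: Kawasaki2000, Def. 2.6; Cesnavicius2021, Def. 3.1 (ii)] -/
theorem IsPStandard.isColonSecantSequence_reverse {xs : List S} (h : IsPStandard M xs) :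
    IsColonSecantSequence M xs.reverse := by
  refine ⟨h.isSecantSequence.of_perm (List.reverse_perm xs).symm h.mem_maximalIdeal,
    fun r hr => h.mem_maximalIdeal r (List.mem_reverse.mp hr), fun i hi => ?_⟩
  -- `xs = (rs.drop (i+1)).reverse ++ rs[i] :: (rs.take i).reverse` for `rs = xs.reverse`
  have e1 : xs.reverse = xs.reverse.take i ++ xs.reverse[i] :: xs.reverse.drop (i + 1) := by
    conv_lhs => rw [← List.take_append_drop i xs.reverse, List.drop_eq_getElem_cons hi]
  have hxs : xs = (xs.reverse.drop (i + 1)).reverse ++ xs.reverse[i] :: (xs.reverse.take i).reverse := by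
    have e2 := congrArg List.reverse e1
    rw [List.reverse_reverse, List.reverse_append, List.reverse_cons, List.append_assoc,
      List.singleton_append] at e2
    exact e2
  have hk := mem_secantColonAnnihilator_of_killsParameterColons (h.kills _ _ _ hxs)
  rwa [secantColonAnnihilator_quotient_congr (M := M)
    (show (ofList (xs.reverse.take i).reverse • ⊤ : Submodule S M) = ofList (xs.reverse.take i) • ⊤ by
      rw [ofList_reverse])] at hk

/-- **`IsPStandard M rs.reverse ↔ IsColonSecantSequence M rs`.**
[cite: Kawasaki2000, Def. 2.6; Cesnavicius2021, Def. 3.1 (ii)] -/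
theorem isPStandard_reverse_iff (rs : List S) : IsPStandard M rs.reverse ↔ IsColonSecantSequence M rs :=
  ⟨fun h => by simpa using h.isColonSecantSequence_reverse, fun h => h.isPStandard_reverse⟩

end Sequences

/-! ## Existence of `p`-standard systems of parameters -/

section Existence

/-- **`p`-standard systems of parameters exist over regular local rings**: a finite module of
dimension `d` over a regular local ring has a `p`-standard sequence of length `d` (type `d-1`;
[Kawasaki2000, Thm. 2.7] assumes a dualizing complex instead). [cite: Kawasaki2000, Thm. 2.7] -/
theorem exists_isPStandard_length_eq {S : Type u} [CommRing S] [IsRegularLocalRing S] {M : Type u}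
    [AddCommGroup M] [Module S M] [Module.Finite S M] {d : ℕ} (hd : Module.supportDim S M = d) :
    ∃ xs : List S, xs.length = d ∧ IsPStandard M xs := by
  obtain ⟨rs, hlen, h⟩ := exists_isColonSecantSequence_length_eq (M := M) hd
  exact ⟨rs.reverse, by rw [List.length_reverse, hlen], h.isPStandard_reverse⟩

/-- **`p`-standard systems of parameters exist over quotients of regular local rings**: for a
surjection `S ↠ R` of local rings with `S` regular, every finite `R`-module of dimension `d` has a
`p`-standard sequence of length `d`. [cite: Kawasaki2000, Thm. 2.7] -/
theorem exists_isPStandard_of_surjective {S R : Type u} [CommRing S] [IsRegularLocalRing S]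
    [CommRing R] [IsLocalRing R] [Algebra S R] (hφ : Function.Surjective (algebraMap S R))
    (M : Type u) [AddCommGroup M] [Module R M] [Module.Finite R M] {d : ℕ}
    (hd : Module.supportDim R M = d) : ∃ xs : List R, xs.length = d ∧ IsPStandard M xs := by
  haveI : IsNoetherianRing R := isNoetherianRing_of_surjective S R (algebraMap S R) hφ
  obtain ⟨rs, hlen, h⟩ := exists_isColonSecantSequence_of_surjective hφ M hd
  exact ⟨rs.reverse, by rw [List.length_reverse, hlen], h.isPStandard_reverse⟩

open _root_.AlgebraicGeometry CategoryTheory in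
/-- **`p`-standard systems of parameters exist over the stalks of schemes locally of finite type
over a field**: for `X → Spec k` locally of finite type, `x ∈ X` and a finite `𝒪_{X,x}`-module `M`
of dimension `d` (e.g. `M = 𝒪_{X,x}`), there is a `p`-standard sequence of length `d` for `M` — the
pointwise input of [Kawasaki2000, Thm. 4.1] for the schemes of `KawasakiMacaulayfication`.
[cite: Kawasaki2000, Thm. 2.7] -/
theorem exists_isPStandard_stalk {k : Type u} [Field k] {X : Scheme.{u}}
    (f : X ⟶ Spec (CommRingCat.of k)) [LocallyOfFiniteType f] (x : X) (M : Type u)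
    [AddCommGroup M] [Module (X.presheaf.stalk x) M] [Module.Finite (X.presheaf.stalk x) M]
    {d : ℕ} (hd : Module.supportDim (X.presheaf.stalk x) M = d) :
    ∃ xs : List (X.presheaf.stalk x), xs.length = d ∧ IsPStandard M xs := by
  haveI : IsLocallyNoetherian X := LocallyOfFiniteType.isLocallyNoetherian f
  obtain ⟨rs, hlen, h⟩ := exists_isColonSecantSequence_stalk f x M hd
  exact ⟨rs.reverse, by rw [List.length_reverse, hlen], h.isPStandard_reverse⟩

end Existence

end Literature.AlgebraicGeometry.Resolution

end
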